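import Summits.Parity.GeneralizedHardyLittlewood.Theorems.PrimeLevelFamEdgeMomentsBeyondDiagonalDiagCornerProfileSum
import Summits.Parity.GeneralizedHardyLittlewood.Theorems.BeyondDiagonalBeatsQuarter.CornerNegligibleXSq
import HarnessLib

/-!
# Route `PrimeLevelFamEdge`, crux K_A `MomentsBeyondDiagonal` (stmt-Parity-20007), line «petersson_layers» v4, stub `stub_diag`:
# **the corner of the diagonal is negligible for every admissible profile**

Census item G7 of the `stub_diag` repair census (`Lines/petersson_layers_stub_diag_g4_bricks.md`), part 3: K_B's
`Corner.abs_corner_le` (`CornerNegligibleXSq`, profile `X²`) for the coefficients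
`x_m = μ(m)ψ(m)⁻¹P(log(M/m)/log M)` of a general real polynomial `P` with `P(0) = 0`:

* `abs_corner_profile_le` — **for `κ > 0` there is `C = C(P,κ)` with
  `|Σ_{a,b≤M} x_a x_b (K_true(Q;a,b) − kmvKernel(log Q;a,b))| ≤ C/log³M` for all `Q ≥ 2`, `2 ≤ M ≤ Q^{2−κ}`**
  (`corner_profile_eq_sum` + `abs_cornerUProfile_le` + the `X²` tail bookkeeping `Corner.corner_tail_le` verbatim,
  threshold `K₁ = ⌊Q^{κ/2}⌋`).

So for every mollifier length `M = q̂^{Δ'}` with `Δ' < 2` the TRUE Petersson diagonal of the mollified second moment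
and KMV's CONTINUED kernel give the same quadratic form up to `O_P(log⁻³M)`, for every admissible profile.
Def-free; theorems only. Helper `--supports stmt-Parity-20007`; closes nothing; K_A, K_B and the Parity summit are NOT
proved; nothing about Landau–Siegel zeros.

## References
* E. Kowalski, P. Michel, J. VanderKam, J. reine angew. Math. 526 (2000), (21)–(23) pp. 12–13 and Prop. 5.1 p. 18.
  [cite: KowalskiMichelVanderKam2000, Prop. 5.1 — derivation (the corner of the diagonal beyond the diagonal, general profile)]
-/

noncomputable section

open scoped Real ArithmeticFunction.Moebius
open Finset ArithmeticFunction Polynomial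

namespace Summit.Parity.GeneralizedHardyLittlewood.Theorems.MomentsBeyondDiagonal.DiagCorner

open Literature.NumberTheory.LFunctions Literature.NumberTheory.LFunctions.KMV2000
open MollifierMainTerm (W)
open Summit.Parity.GeneralizedHardyLittlewood.Theorems.BeyondDiagonalBeatsQuarter.KernelFormXSq
  (copTauW divWeight divWeight_nonneg abs_W_le)
open Summit.Parity.GeneralizedHardyLittlewood.Theorems.BeyondDiagonalBeatsQuarter.Corner

set_option maxHeartbeats 400000 in
/-- **The corner of the diagonal is `O_P(1/log³M)` for every profile with `P(0) = 0`.** For `κ > 0` there is `C`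
with `|Σ_{a,b ≤ M} x_a x_b (trueDiagKernel Q a b − kmvKernel (log Q) a b)| ≤ C/log³M` whenever `Q ≥ 2` and
`2 ≤ M ≤ Q^{2−κ}`, `x_m = μ(m)ψ(m)⁻¹P(log(M/m)/log M)`.
[cite: KowalskiMichelVanderKam2000, (21)–(23) pp. 12–13 and Prop. 5.1 p. 18 — derivation (the corner of the diagonal beyond the diagonal, general profile)] -/
theorem abs_corner_profile_le (P : ℝ[X]) (hP0 : P.coeff 0 = 0) {κ : ℝ} (hκ : 0 < κ) :
    ∃ C : ℝ, 0 < C ∧ ∀ Q M : ℝ, 2 ≤ Q → 2 ≤ M → M ≤ Q ^ (2 - κ) →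
      |∑ a ∈ Icc 1 ⌊M⌋₊, ∑ b ∈ Icc 1 ⌊M⌋₊,
          ((μ a : ℝ) * ((psi a)⁻¹ * P.eval (Real.log (M / a) / Real.log M))) *
            ((μ b : ℝ) * ((psi b)⁻¹ * P.eval (Real.log (M / b) / Real.log M))) *
          (trueDiagKernel Q a b - kmvKernel (Real.log Q) a b)| ≤
        C / Real.log M ^ 3 := by
  obtain ⟨C₁, C₂, hC₁, hC₂, hU⟩ := abs_cornerUProfile_le P hP0
  obtain ⟨Cκ, hCκ, hCκb⟩ := rpow_neg_le_div_log_pow (show 0 < κ / 4 by positivity) 10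
  set Z₂ : ℝ := (∑' d : ℕ, (d : ℝ) ^ (-(5 / 4 : ℝ))) ^ 2 with hZ₂
  set W₁ : ℝ := scriptW 1 with hW₁
  have hW₁0 : 0 ≤ W₁ := scriptW_nonneg zero_le_one
  have hZ₂0 : 0 ≤ Z₂ := sq_nonneg _
  -- the final constant
  set Ctot : ℝ := 32 * (128 * Real.sqrt 2 * C₁ * Cκ + 32 * C₂ * (6 / κ) ^ 12 * (W₁ + 10) * Z₂ + 1)
    with hCtot
  refine ⟨Ctot, by positivity, fun Q M hQ2 hM2 hMQ ↦ ?_⟩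
  -- notation and basic facts
  have hQ1 : 1 ≤ Q := by linarith
  have hQ0 : 0 < Q := by linarith
  have hM1 : 1 ≤ M := by linarith
  have hM1' : 1 < M := by linarith
  have hM0 : 0 < M := by linarith
  set N : ℕ := ⌊M⌋₊ with hNdef
  have hN1 : 1 ≤ N := Nat.le_floor (by simpa using hM1)
  have hNM : (N : ℝ) ≤ M := Nat.floor_le hM0.le
  set L : ℝ := Real.log M with hLdef
  set LQ : ℝ := Real.log Q with hLQdef
  have hl2 : (1 : ℝ) / 2 < Real.log 2 := by have := Real.log_two_gt_d9; linarith
  have hL2 : Real.log 2 ≤ L := Real.log_le_log two_pos hM2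
  have hLQ2 : Real.log 2 ≤ LQ := Real.log_le_log two_pos hQ2
  have hL0 : 0 < L := by linarith
  have hLQ0 : 0 < LQ := by linarith
  have hLLQ : L ≤ 2 * LQ := by
    have := Real.log_le_log hM0 hMQ
    rw [Real.log_rpow hQ0] at this
    nlinarith
  have hlogN : Real.log N ≤ L := Real.log_le_log (by exact_mod_cast hN1) hNM
  have hlogN0 : 0 ≤ Real.log N := Real.log_nonneg (by exact_mod_cast hN1)
  -- the threshold
  obtain ⟨hK1, hKQ, hKlog⟩ := floor_rpow_facts hQ1 (show 0 < κ / 2 by positivity)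
  set K₁ : ℕ := ⌊Q ^ (κ / 2)⌋₊ with hK₁def
  have hKlog' : 0 < 1 + Real.log (K₁ : ℝ) := by
    have : 0 ≤ Real.log (K₁ : ℝ) := Real.log_natCast_nonneg K₁; linarith
  -- (c) 1/(1+log K₁)^12 ≤ (2/κ)^12 / LQ^12
  have hcK : C₂ / (1 + Real.log (K₁ : ℝ)) ^ 12 ≤ C₂ * (2 / κ) ^ 12 / LQ ^ 12 := by
    have hx0 : LQ ≤ 2 / κ * (1 + Real.log (K₁ : ℝ)) := by
      have := mul_le_mul_of_nonneg_left hKlog (show (0 : ℝ) ≤ 2 / κ by positivity)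
      rwa [show 2 / κ * (κ / 2 * Real.log Q) = LQ by rw [hLQdef]; field_simp] at this
    have hx : LQ ^ 12 ≤ (2 / κ * (1 + Real.log (K₁ : ℝ))) ^ 12 := pow_le_pow_left₀ hLQ0.le hx0 12
    rw [div_le_div_iff₀ (by positivity) (by positivity), mul_pow] at *
    nlinarith [hC₂]
  -- (b) √(2K₁M)/Q ≤ √2 · Q^{-κ/4}
  have hb : Real.sqrt (2 * K₁ * M) / Q ≤ Real.sqrt 2 * Q ^ (-(κ / 4)) := by
    have h1 : 2 * (K₁ : ℝ) * M ≤ 2 * (Q ^ (1 - κ / 4)) ^ 2 := by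
      have hKM : (K₁ : ℝ) * M ≤ Q ^ (κ / 2) * Q ^ (2 - κ) := mul_le_mul hKQ hMQ hM0.le (by positivity)
      have hsq : (Q ^ (1 - κ / 4)) ^ 2 = Q ^ (κ / 2) * Q ^ (2 - κ) := by
        rw [← Real.rpow_add hQ0, ← Real.rpow_natCast, ← Real.rpow_mul hQ0.le]
        congr 1; push_cast; ring
      rw [hsq]; linarith
    have h2 : Real.sqrt (2 * K₁ * M) ≤ Real.sqrt 2 * Q ^ (1 - κ / 4) := by
      calc Real.sqrt (2 * K₁ * M) ≤ Real.sqrt (2 * (Q ^ (1 - κ / 4)) ^ 2) := Real.sqrt_le_sqrt h1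
        _ = Real.sqrt 2 * Q ^ (1 - κ / 4) := by
            rw [Real.sqrt_mul (by norm_num), Real.sqrt_sq (by positivity)]
    rw [div_le_iff₀ hQ0]
    refine h2.trans (le_of_eq ?_)
    rw [mul_assoc, ← Real.rpow_add_one hQ0.ne']
    congr 1; ring
  have hQκ : Q ^ (-(κ / 4)) ≤ Cκ / (1 + LQ) ^ 10 := hCκb Q hQ1
  -- the two amplitudes
  set A₁ : ℝ := 2 * (1 + L) ^ 2 * (C₁ * (Real.sqrt 2 * Q ^ (-(κ / 4)))) with hA₁
  set A₂ : ℝ := 2 * (1 + L) ^ 2 * (2 * (C₂ * (2 / κ) ^ 12 / LQ ^ 12) * (W₁ + 2 + 4 * L + 2 * LQ))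
    with hA₂
  have hA₁0 : 0 ≤ A₁ := by positivity
  have hA₂0 : 0 ≤ A₂ := by positivity
  -- the per-term bound
  have hterm : ∀ c ∈ Icc 1 N, ∀ d ∈ Icc 1 (N / c),
      |(μ d : ℝ) * c * W (c * d) ^ 2 *
        ∑ k₁ ∈ Icc 1 ⌊M / ((c * d : ℕ) : ℝ)⌋₊, ∑ k₂ ∈ Icc 1 ⌊M / ((c * d : ℕ) : ℝ)⌋₊,
          copTauW (c * d) k₁ * copTauW (c * d) k₂ *
            P.eval (ellp (M / ((c * d : ℕ) : ℝ)) k₁ / Real.log M) *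
              P.eval (ellp (M / ((c * d : ℕ) : ℝ)) k₂ / Real.log M) *
                cornerE ((d : ℝ) ^ 2 / Q ^ 2 * k₁ * k₂)| ≤
        divWeight (c * d) / ((c : ℝ) * d) * A₁ + divWeight (c * d) / ((c : ℝ) * d ^ 2) * A₂ := by
    intro c hc d hd
    have hc1 := (Finset.mem_Icc.1 hc).1
    have hd1 := (Finset.mem_Icc.1 hd).1
    have hdN : d ≤ N := (Finset.mem_Icc.1 hd).2.trans (Nat.div_le_self N c)
    have hc0 : (0 : ℝ) < c := by exact_mod_cast hc1
    have hd0 : (0 : ℝ) < d := by exact_mod_cast hd1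
    have hcd0 : c * d ≠ 0 := by positivity
    have hn0 : (0 : ℝ) < ((c * d : ℕ) : ℝ) := by positivity
    -- n = cd ≤ N ≤ M
    have hnN : c * d ≤ N := by
      have := (Finset.mem_Icc.1 hd).2
      calc c * d ≤ c * (N / c) := Nat.mul_le_mul_left c this
        _ ≤ N := Nat.mul_div_le N c
    have hnM : ((c * d : ℕ) : ℝ) ≤ M := le_trans (by exact_mod_cast hnN) hNM
    have hD := divWeight_nonneg (c * d)
    -- Y = M/n ∈ [1, M]
    have hY1 : 1 ≤ M / ((c * d : ℕ) : ℝ) := by rw [le_div_iff₀ hn0]; linarith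
    have hYM : M / ((c * d : ℕ) : ℝ) ≤ M :=
      div_le_self hM0.le (by exact_mod_cast Nat.one_le_iff_ne_zero.2 hcd0)
    have hlogY0 : 0 ≤ Real.log (M / ((c * d : ℕ) : ℝ)) := Real.log_nonneg hY1
    have hlogY : Real.log (M / ((c * d : ℕ) : ℝ)) ≤ L := Real.log_le_log (by positivity) hYM
    -- the U bound at K₁
    have hUb := hU (c * d) hcd0 d (by omega) Q M hQ0 hM1' hnM K₁
    -- |μ d · c · W(n)²| ≤ c/n²
    have hW : W (c * d) ^ 2 ≤ (((c * d : ℕ) : ℝ))⁻¹ ^ 2 := by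
      rw [← sq_abs]; exact pow_le_pow_left₀ (abs_nonneg _) (abs_W_le (c * d)) 2
    have hμ : |(μ d : ℝ)| ≤ 1 := by exact_mod_cast ArithmeticFunction.abs_moebius_le_one
    -- pieces of the bracket
    have hlog2 : 2 * (1 + Real.log (M / ((c * d : ℕ) : ℝ))) ^ 2 ≤ 2 * (1 + L) ^ 2 := by gcongr
    have hR : Real.sqrt (2 * ((d : ℝ) ^ 2 / Q ^ 2) * K₁ * (M / ((c * d : ℕ) : ℝ))) ≤
        d * (Real.sqrt 2 * Q ^ (-(κ / 4))) := by
      have h1 : 2 * ((d : ℝ) ^ 2 / Q ^ 2) * K₁ * (M / ((c * d : ℕ) : ℝ)) ≤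
          (d * (Real.sqrt (2 * K₁ * M) / Q)) ^ 2 := by
        rw [mul_pow, div_pow, Real.sq_sqrt (by positivity)]
        have hK0 : (0 : ℝ) ≤ K₁ := Nat.cast_nonneg _
        have : M / ((c * d : ℕ) : ℝ) ≤ M := hYM
        have e : (d : ℝ) ^ 2 * (2 * K₁ * M / Q ^ 2) = 2 * ((d : ℝ) ^ 2 / Q ^ 2) * K₁ * M := by ring
        rw [e]
        gcongr
      calc Real.sqrt (2 * ((d : ℝ) ^ 2 / Q ^ 2) * K₁ * (M / ((c * d : ℕ) : ℝ)))
          ≤ Real.sqrt ((d * (Real.sqrt (2 * K₁ * M) / Q)) ^ 2) := Real.sqrt_le_sqrt h1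
        _ = d * (Real.sqrt (2 * K₁ * M) / Q) := Real.sqrt_sq (by positivity)
        _ ≤ d * (Real.sqrt 2 * Q ^ (-(κ / 4))) := mul_le_mul_of_nonneg_left hb hd0.le
    have hG : scriptW 1 + 2 + |Real.log ((d : ℝ) ^ 2 / Q ^ 2)| + 2 * Real.log (M / ((c * d : ℕ) : ℝ)) ≤
        W₁ + 2 + 4 * L + 2 * LQ := by
      have hlogd : Real.log (d : ℝ) ≤ L :=
        (Real.log_le_log hd0 (by exact_mod_cast hdN)).trans hlogN
      have hlogd0 : 0 ≤ Real.log (d : ℝ) := Real.log_nonneg (by exact_mod_cast hd1)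
      have habs : |Real.log ((d : ℝ) ^ 2 / Q ^ 2)| ≤ 2 * L + 2 * LQ := by
        rw [Real.log_div (by positivity) (by positivity), Real.log_pow, Real.log_pow]
        push_cast
        refine (abs_sub _ _).trans ?_
        rw [abs_of_nonneg (by positivity), abs_of_nonneg (by positivity)]
        linarith
      rw [hW₁]; linarith
    -- combine
    have hbracket : C₁ * Real.sqrt (2 * ((d : ℝ) ^ 2 / Q ^ 2) * K₁ * (M / ((c * d : ℕ) : ℝ))) +
        2 * (C₂ / (1 + Real.log (K₁ : ℝ)) ^ 12) *
          (scriptW 1 + 2 + |Real.log ((d : ℝ) ^ 2 / Q ^ 2)| + 2 * Real.log (M / ((c * d : ℕ) : ℝ))) ≤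
        d * (C₁ * (Real.sqrt 2 * Q ^ (-(κ / 4)))) +
          2 * (C₂ * (2 / κ) ^ 12 / LQ ^ 12) * (W₁ + 2 + 4 * L + 2 * LQ) := by
      have h1 : C₁ * Real.sqrt (2 * ((d : ℝ) ^ 2 / Q ^ 2) * K₁ * (M / ((c * d : ℕ) : ℝ))) ≤
          d * (C₁ * (Real.sqrt 2 * Q ^ (-(κ / 4)))) := by
        have := mul_le_mul_of_nonneg_left hR hC₁.le; linarith
      have hGpos : 0 ≤ scriptW 1 + 2 + |Real.log ((d : ℝ) ^ 2 / Q ^ 2)| +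
          2 * Real.log (M / ((c * d : ℕ) : ℝ)) := by rw [← hW₁]; positivity
      have h2 := mul_le_mul (mul_le_mul_of_nonneg_left hcK zero_le_two) hG hGpos (by positivity)
      linarith
    -- |U_P| ≤ D · 2(1+L)² · bracket
    have hU' : |∑ k₁ ∈ Icc 1 ⌊M / ((c * d : ℕ) : ℝ)⌋₊, ∑ k₂ ∈ Icc 1 ⌊M / ((c * d : ℕ) : ℝ)⌋₊,
        copTauW (c * d) k₁ * copTauW (c * d) k₂ *
          P.eval (ellp (M / ((c * d : ℕ) : ℝ)) k₁ / Real.log M) *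
            P.eval (ellp (M / ((c * d : ℕ) : ℝ)) k₂ / Real.log M) *
              cornerE ((d : ℝ) ^ 2 / Q ^ 2 * k₁ * k₂)| ≤
        divWeight (c * d) * (2 * (1 + L) ^ 2) *
          (d * (C₁ * (Real.sqrt 2 * Q ^ (-(κ / 4)))) +
            2 * (C₂ * (2 / κ) ^ 12 / LQ ^ 12) * (W₁ + 2 + 4 * L + 2 * LQ)) := by
      refine hUb.trans ?_
      have hbpos : 0 ≤ C₁ * Real.sqrt (2 * ((d : ℝ) ^ 2 / Q ^ 2) * K₁ * (M / ((c * d : ℕ) : ℝ))) +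
          2 * (C₂ / (1 + Real.log (K₁ : ℝ)) ^ 12) *
            (scriptW 1 + 2 + |Real.log ((d : ℝ) ^ 2 / Q ^ 2)| + 2 * Real.log (M / ((c * d : ℕ) : ℝ))) := by
        positivity
      exact mul_le_mul (mul_le_mul_of_nonneg_left hlog2 hD) hbracket hbpos (by positivity)
    have hcoef : |(μ d : ℝ) * c * W (c * d) ^ 2| ≤ c * (((c * d : ℕ) : ℝ))⁻¹ ^ 2 := by
      rw [abs_mul, abs_mul, abs_of_pos hc0, abs_of_nonneg (sq_nonneg (W (c * d)))]
      calc |(μ d : ℝ)| * c * W (c * d) ^ 2 ≤ 1 * c * (((c * d : ℕ) : ℝ))⁻¹ ^ 2 := by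
            gcongr
        _ = c * (((c * d : ℕ) : ℝ))⁻¹ ^ 2 := by ring
    rw [abs_mul]
    refine (mul_le_mul hcoef hU' (abs_nonneg _) (by positivity)).trans (le_of_eq ?_)
    have hcne : (c : ℝ) ≠ 0 := hc0.ne'
    have hdne : (d : ℝ) ≠ 0 := hd0.ne'
    rw [hA₁, hA₂]
    push_cast
    field_simp
  -- sum the per-term bounds
  rw [corner_profile_eq_sum P hM1 hQ0]
  have hsum : |∑ c ∈ Icc 1 N, ∑ d ∈ Icc 1 (N / c), (μ d : ℝ) * c * W (c * d) ^ 2 *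
      ∑ k₁ ∈ Icc 1 ⌊M / ((c * d : ℕ) : ℝ)⌋₊, ∑ k₂ ∈ Icc 1 ⌊M / ((c * d : ℕ) : ℝ)⌋₊,
        copTauW (c * d) k₁ * copTauW (c * d) k₂ *
          P.eval (ellp (M / ((c * d : ℕ) : ℝ)) k₁ / Real.log M) *
            P.eval (ellp (M / ((c * d : ℕ) : ℝ)) k₂ / Real.log M) *
              cornerE ((d : ℝ) ^ 2 / Q ^ 2 * k₁ * k₂)| ≤
      A₁ * (1 + Real.log N) ^ 4 + A₂ * (Z₂ * (2 + Real.log N)) := by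
    calc _ ≤ ∑ c ∈ Icc 1 N, ∑ d ∈ Icc 1 (N / c), |(μ d : ℝ) * c * W (c * d) ^ 2 *
          ∑ k₁ ∈ Icc 1 ⌊M / ((c * d : ℕ) : ℝ)⌋₊, ∑ k₂ ∈ Icc 1 ⌊M / ((c * d : ℕ) : ℝ)⌋₊,
            copTauW (c * d) k₁ * copTauW (c * d) k₂ *
              P.eval (ellp (M / ((c * d : ℕ) : ℝ)) k₁ / Real.log M) *
                P.eval (ellp (M / ((c * d : ℕ) : ℝ)) k₂ / Real.log M) *
                  cornerE ((d : ℝ) ^ 2 / Q ^ 2 * k₁ * k₂)| := by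
          refine (Finset.abs_sum_le_sum_abs _ _).trans (Finset.sum_le_sum fun c _ ↦ ?_)
          exact Finset.abs_sum_le_sum_abs _ _
      _ ≤ ∑ c ∈ Icc 1 N, ∑ d ∈ Icc 1 (N / c),
          (divWeight (c * d) / ((c : ℝ) * d) * A₁ + divWeight (c * d) / ((c : ℝ) * d ^ 2) * A₂) :=
          Finset.sum_le_sum fun c hc ↦ Finset.sum_le_sum fun d hd ↦ hterm c hc d hd
      _ = (∑ c ∈ Icc 1 N, ∑ d ∈ Icc 1 (N / c), divWeight (c * d) / ((c : ℝ) * d)) * A₁ +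
          (∑ c ∈ Icc 1 N, ∑ d ∈ Icc 1 (N / c), divWeight (c * d) / ((c : ℝ) * d ^ 2)) * A₂ := by
          rw [Finset.sum_mul, Finset.sum_mul, ← Finset.sum_add_distrib]
          refine Finset.sum_congr rfl fun c _ ↦ ?_
          rw [Finset.sum_mul, Finset.sum_mul, ← Finset.sum_add_distrib]
      _ ≤ (1 + Real.log N) ^ 4 * A₁ + (Z₂ * (2 + Real.log N)) * A₂ :=
          add_le_add (mul_le_mul_of_nonneg_right (sum_sum_divWeight_div_mul_le N) hA₁0)
            (mul_le_mul_of_nonneg_right (sum_sum_divWeight_div_mul_sq_le hN1) hA₂0)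
      _ = A₁ * (1 + Real.log N) ^ 4 + A₂ * (Z₂ * (2 + Real.log N)) := by ring
  have hq0 : 0 ≤ Q ^ (-(κ / 4)) := by positivity
  exact hsum.trans (corner_tail_le hC₁ hC₂ hCκ hW₁0 hZ₂0 hκ (by linarith) hL0 hLLQ hlogN0 hlogN hq0 hQκ
    hA₁ hA₂ hCtot)

end Summit.Parity.GeneralizedHardyLittlewood.Theorems.MomentsBeyondDiagonal.DiagCorner

end
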